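import Literature.MathematicalPhysics.QuantumFieldTheory.Balaban1983to89.Node00.Sect2RegionGeometry

/-!
# BalabanUVNodes ∕ node N18 = NE5 — closure-ledger item (iii), the (I.1.12) half of the transport clause: THE LEVEL NESTING (α) OF CONDITIONS (i)–(iii)
# OF [I] (1.11)–(1.14) AT THE FRAME OF RECORD — an `LM`-cube of `T^{(j)}` lies in an `LM`-cube of `T^{(k)}` (`j ≤ k`), and the level-`k` local gauge serves
# level `j` after the rescaling `A ↦ (ξ_k ∕ ξ_j)·A` (Track A, DAG node N18 = `T4OutputRate.NE5` :211; cluster K4 «SpineRates», item K3⁷ `SpineGivenEndpointR13SepCoPH`;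
# module 19b of seat pub-ymgap-dag-n18-d, strategy s2)

HONEST FRAMING.  Count-neutral kernel bookkeeping (`--supports stmt-QuantumFields-20544 --as helper`); elementary, PROVED.  NE5 is NOT PRINTED and NOT proved;
N18 is NOT discharged; the transport clause `hT` at the table of record `spaceI` is NOT discharged here; CONDITION (iv) (1.15)–(1.16) IS NOT NESTED (see below).

WHY.  The LENS «transfer» card T36 (`ym-lens-BalabanUVNodes-transfer/LENS-transfer.md` §29, FAN-OUT row v23) reduces the (1.12) half of the transport clause
`hT : ∀ U, (∀ j Y, (ιU, 0) ∈ spaceI … (k+1) j Y …) → ∀ j Y, (ι(T₀U), 0) ∈ spaceI … k j Y …` to the TOP level by a NESTING lemma: at ONE table `Y`, the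
level-`k` condition (1.12) — on every `LM`-cube `□` of `T^{(k)}` meeting `X` a `G`-valued `u` with `U^u = exp iξ_kA`, `|A|, |∇^{ξ_k}A| < cB·α₀` on `□ ∩ X`
(`B12RegularSpaces111.CondI.localGauge` over `Node00.Sect2.cubesI M k Y`, `ξ_k = P.eta k = L^{−k}`) — implies the level-`j` condition for every `j ≤ k`:
the `LM`-cubes of `T^{(j)}` (side `L^{j+1}M` fine sites, `Sect2.cubesI`, `B14.Eq213MaximalDomains.side`) NEST in those of `T^{(k)}` (side `L^{k+1}M = L^{k−j}·L^{j+1}M`,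
SAME anchoring `cubeExt s a 0 = {s·aᵢ ≤ zᵢ ≤ s·aᵢ + s − 1}`: the `s`-cube of index `a` lies in the `t·s`-cube of index `⌊a∕t⌋`), the local gauge RESTRICTS, and
with `A′ := (ξ_k∕ξ_j)·A` one has `exp iξ_kA = exp iξ_jA′`, `|A′| ≤ |A|`, `|∇^{ξ_j}A′| = (ξ_k∕ξ_j)²|∇^{ξ_k}A| ≤ |∇^{ξ_k}A|` (room `L^{k−j}`, `L^{2(k−j)}`); the
plaquette letter (1.11) `α₀ξ_k² ≤ α₀ξ_j²` and (ii)–(iii) nest the same way (the factorisation `𝐔 = (exp iξA′)U` re-scaled).  So only the TOP level of the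
transported tower has to be produced by the (0.4) average ((β)∕(γ) of the lens road, not here), the levels below ride on this file.

WHAT.
* §1 cube geometry on the cover and the torus: `cubeExt_subset_cubeExt_mul`, `lt_ceilDiv_iff_mul_lt`, `ediv_mem_cubeIndices_mul`, `cubeEnl_subset_cubeEnl_mul`,
  `side_succ_eq_pow_mul_side_succ`, ★ `cubesI_nest` (`j ≤ k ⇒` every (1.12) cube-region of level `j` at `Y` is a sub-region — bonds, stencils — of one of level `k`).
* §2 the `ξ`-rescaling at the level of [I]'s predicates (any frames, `0 < ξ ≤ ξ′`, same `cB`): `expI_eq_expI_smul`, `norm_real_smul_le`, `grad_smul_eq`, `nabla_smul_eq`,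
  `localGauge_of_xi_le`, ★ `condI_of_xi_le`, `condII_of_xi_le`, `condIII_of_xi_le`, `factors_of_xi_le`, ★ `satisfiesI_III_of_xi_le`.
* §3 at the frame of record: `eta_le_eta_of_le` (`0 < ξ_k` is `BIJ85Sigma422Eta.eta_pos`, cited), ★ `condI_frameI_of_level_le`, ★ `satisfiesI_III_frameI_of_level_le` (any residual recipes `Rz, Rz′` —
  conditions (i)–(iii) do not read them).
Sibling module 19a `…N18CondIKRow` types King's K-row for `bondAvg` (the first-order engine of the top-level step).

WHAT THIS IS NOT.  Condition (iv) does NOT nest across levels (its region `X̃⁻²` = `innerT P (side L M j) 2 Y` GROWS as `j` decreases and its functions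
`Rz.bgI j Y` are level data) — nothing about `CondIV`, `Satisfies` or `spaceI` membership is claimed; not the transport clause; not an estimate; finite tori, fixed
`ε` — not continuum ∕ OS ∕ mass gap ∕ Clay.  0 `def`, 0 `sorry`, standard axioms.
-/

open Set
open scoped BigOperators

namespace YMDAG.N18.CondILevelNesting

open Literature.MathematicalPhysics.QuantumFieldTheory.Balaban1983to89
open Literature.MathematicalPhysics.QuantumFieldTheory.Balaban1983to89.B14DomainGeom (Pt)
open Literature.MathematicalPhysics.QuantumFieldTheory.Balaban1983to89.B14.Eq213MaximalDomains (cubeExt side)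
open Literature.MathematicalPhysics.QuantumFieldTheory.Balaban1983to89.B15Eq112TorusCover (cover)
open Literature.MathematicalPhysics.QuantumFieldTheory.Balaban1983to89.Node00 (cubeIndices cubeEnl)
open Literature.MathematicalPhysics.QuantumFieldTheory.Balaban1983to89.Node00.Sect2 (regionOfSet cubesI frameI Residual regionOfSet_bonds_mono
  regionOfSet_dpairs_mono)
open Literature.MathematicalPhysics.QuantumFieldTheory.Balaban1983to89.B12RegularSpaces111

/-! ## §1 THE `LM`-CUBES OF `T^{(j)}` NEST IN THOSE OF `T^{(k)}`, `j ≤ k` -/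

section Cubes

variable {d : ℕ}

/-- On the cover `ℤᵈ`: the `s`-cube of index `a` lies in the `t·s`-cube of index `⌊a∕t⌋` (`0 < t`; same anchoring `{s·aᵢ ≤ zᵢ ≤ s·aᵢ + s − 1}`).
[cite: Balaban1988Convergent, (2.13) pp.256–257 («the partitions are nested»)] -/
theorem cubeExt_subset_cubeExt_mul (s : ℕ) {t : ℕ} (ht : 0 < t) (a : Pt d) :
    cubeExt s a 0 ⊆ cubeExt (t * s) (fun i => a i / (t : ℤ)) 0 := by
  intro z hz i
  obtain ⟨h1, h2⟩ := hz i
  have ht0 : (0 : ℤ) < t := by exact_mod_cast ht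
  have hs0 : (0 : ℤ) ≤ s := Int.natCast_nonneg s
  have hdiv : (t : ℤ) * (a i / (t : ℤ)) + a i % (t : ℤ) = a i := Int.mul_ediv_add_emod (a i) (t : ℤ)
  have hr0 : 0 ≤ a i % (t : ℤ) := Int.emod_nonneg _ ht0.ne'
  have hrt : a i % (t : ℤ) < t := Int.emod_lt_of_pos _ ht0
  set q := a i / (t : ℤ) with hq
  set r := a i % (t : ℤ) with hr
  have hai : a i = t * q + r := hdiv.symm
  rw [hai] at h1 h2
  show ((t * s : ℕ) : ℤ) * q - 0 ≤ z i ∧ z i ≤ ((t * s : ℕ) : ℤ) * q + ((t * s : ℕ) : ℤ) - 1 + 0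
  push_cast
  constructor
  · nlinarith
  · nlinarith

/-- `n < ⌈S∕s⌉ ↔ n·s < S` for `0 < s`, with `⌈S∕s⌉ = (S + s − 1)∕s` (the cube-index bound of `Node00.cubeIndices`). [folklore] -/
theorem lt_ceilDiv_iff_mul_lt {S s n : ℕ} (hs : 0 < s) : n < (S + s - 1) / s ↔ n * s < S := by
  rw [Nat.lt_iff_add_one_le, Nat.le_div_iff_mul_le hs]
  constructor
  · intro h; rw [Nat.add_mul, one_mul] at h; omega
  · intro h; rw [Nat.add_mul, one_mul]; omega

variable {P : Params}

/-- On the index families of `Node00.cubeIndices`: if `a` indexes an `s`-cube of the torus partition then `⌊a∕t⌋` indexes a `t·s`-cube (`0 < t`).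
[cite: Balaban1988Convergent, (2.17) p.257 («compatible with all other partitions»)] -/
theorem ediv_mem_cubeIndices_mul {s t : ℕ} (ht : 0 < t) {a : Pt P.d} (ha : a ∈ cubeIndices P s) :
    (fun i => a i / (t : ℤ)) ∈ cubeIndices P (t * s) := by
  rw [cubeIndices, Fintype.mem_piFinset] at ha ⊢
  intro i
  obtain ⟨n, hn, hna⟩ := Finset.mem_image.mp (ha i)
  rw [Finset.mem_range] at hn
  refine Finset.mem_image.mpr ⟨n / t, ?_, ?_⟩
  · rw [Finset.mem_range]
    rcases Nat.eq_zero_or_pos s with hs | hs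
    · subst hs; simp at hn
    · have hts : 0 < t * s := Nat.mul_pos ht hs
      rw [lt_ceilDiv_iff_mul_lt hs] at hn
      rw [lt_ceilDiv_iff_mul_lt hts]
      calc n / t * (t * s) = (n / t * t) * s := by ring
        _ ≤ n * s := Nat.mul_le_mul_right _ (Nat.div_mul_le_self n t)
        _ < P.sitesPerDir 0 := hn
  · rw [← hna]
    exact Int.natCast_div n t

/-- On the torus: the `s`-cube of index `a` (`Node00.cubeEnl P s a 0`) lies in the `t·s`-cube of index `⌊a∕t⌋` (`0 < t`).
[cite: Balaban1988Convergent, (2.13) pp.256–257 («the partitions are nested»)] -/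
theorem cubeEnl_subset_cubeEnl_mul (s : ℕ) {t : ℕ} (ht : 0 < t) (a : Pt P.d) :
    cubeEnl P s a 0 ⊆ cubeEnl P (t * s) (fun i => a i / (t : ℤ)) 0 := by
  simp only [cubeEnl, zero_mul, Nat.cast_zero]
  exact image_mono (cubeExt_subset_cubeExt_mul s ht a)

/-- The (1.12) cube sides across levels: `side L M (k+1) = L^{k−j} · side L M (j+1)` for `j ≤ k` (`side L M n = LⁿM`).
[cite: Balaban1988Convergent, (2.13) pp.256–257] -/
theorem side_succ_eq_pow_mul_side_succ (L M : ℕ) {j k : ℕ} (hjk : j ≤ k) : side L M (k + 1) = L ^ (k - j) * side L M (j + 1) := by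
  unfold side
  rw [← mul_assoc, ← pow_add]
  congr 2
  omega

/-- ★ **THE (I.1.12) CUBE-REGIONS NEST ACROSS LEVELS AT ONE TABLE**: for `j ≤ k`, every cube-region of `Sect2.cubesI M j Y` (an `LM`-cube `□` of `T^{(j)}` meeting
`Y`, as the region `□ ∩ Y`) is a sub-region — bonds and derivative stencils — of a cube-region of `Sect2.cubesI M k Y` (the `LM`-cube `□′ ⊇ □` of `T^{(k)}`, which
meets `Y` because `□` does; `□ ∩ Y ⊆ □′ ∩ Y`). [cite: Balaban1987RG1, (1.12) p.262] -/
theorem cubesI_nest (M : ℕ) {j k : ℕ} (hjk : j ≤ k) (Y : Set (Site P 0)) :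
    ∀ C' ∈ cubesI (P := P) M j Y, ∃ C ∈ cubesI (P := P) M k Y, C'.bonds ⊆ C.bonds ∧ C'.dpairs ⊆ C.dpairs := by
  rintro C' ⟨a, ha, hne, rfl⟩
  have ht : 0 < P.L ^ (k - j) := pow_pos P.L_pos _
  have hside : side P.L M (k + 1) = P.L ^ (k - j) * side P.L M (j + 1) := side_succ_eq_pow_mul_side_succ P.L M hjk
  set a' : Pt P.d := fun i => a i / ((P.L ^ (k - j) : ℕ) : ℤ) with ha'
  have hmem : a' ∈ cubeIndices P (side P.L M (k + 1)) := by
    rw [hside]; exact ediv_mem_cubeIndices_mul ht ha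
  have hsub : cubeEnl P (side P.L M (j + 1)) a 0 ∩ Y ⊆ cubeEnl P (side P.L M (k + 1)) a' 0 ∩ Y := by
    refine inter_subset_inter_left _ ?_
    rw [hside]; exact cubeEnl_subset_cubeEnl_mul _ ht a
  exact ⟨regionOfSet P (cubeEnl P (side P.L M (k + 1)) a' 0 ∩ Y), ⟨a', hmem, hne.mono hsub, rfl⟩, regionOfSet_bonds_mono hsub,
    regionOfSet_dpairs_mono hsub⟩

end Cubes

/-! ## §2 THE `ξ`-RESCALING `A ↦ (ξ ∕ ξ′)·A` OF (1.12)–(1.13): conditions (i)–(iii) pass from `ξ` to any `ξ′ ≥ ξ > 0` (same `cB`) along a frame refinement -/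

section Rescale

variable {P : Params} {i : ℕ} {𝔸 : Type*} [NormedRing 𝔸] [NormedAlgebra ℂ 𝔸] [CompleteSpace 𝔸] {𝓜 : Model 𝔸}

/-- `exp iξa = exp iξ′((ξ∕ξ′)a)` (`ξ′ ≠ 0`). [cite: Balaban1987RG1, (1.12) p.262] -/
theorem expI_eq_expI_smul {ξ ξ' : ℝ} (hξ' : ξ' ≠ 0) (a : 𝔸) : expI ξ a = expI ξ' (((ξ / ξ' : ℝ) : ℂ) • a) := by
  have hξ'c : (ξ' : ℂ) ≠ 0 := Complex.ofReal_ne_zero.mpr hξ'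
  unfold expI
  congr 1
  rw [smul_smul]
  congr 1
  push_cast
  rw [mul_div_assoc', mul_comm (Complex.I * ξ') ξ, ← mul_assoc, mul_div_assoc, div_self hξ'c, mul_one, mul_comm]

omit [CompleteSpace 𝔸] in
/-- `‖(ρ : ℂ)·a‖ ≤ ‖a‖` for `0 ≤ ρ ≤ 1`. [folklore] -/
theorem norm_real_smul_le {ρ : ℝ} (h0 : 0 ≤ ρ) (h1 : ρ ≤ 1) (a : 𝔸) : ‖((ρ : ℝ) : ℂ) • a‖ ≤ ‖a‖ := by
  rw [norm_smul, Complex.norm_real, Real.norm_of_nonneg h0]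
  exact mul_le_of_le_one_left (norm_nonneg _) h1

omit [CompleteSpace 𝔸] in
/-- `∇^{ξ′}((ξ∕ξ′)F) = (ξ∕ξ′)²·∇^{ξ}F` (with the zero conventions, any `ξ, ξ′`). [cite: Balaban1987RG1, (1.12) p.262] -/
theorem grad_smul_eq (ξ ξ' : ℝ) (μ : Fin P.d) (F : Site P i → 𝔸) (x : Site P i) :
    grad ξ' μ (fun y => ((ξ / ξ' : ℝ) : ℂ) • F y) x = (((ξ / ξ') ^ 2 : ℝ) : ℂ) • grad ξ μ F x := by
  simp only [grad, ← smul_sub, smul_smul]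
  congr 1
  push_cast
  field_simp

omit [CompleteSpace 𝔸] in
/-- `∇^{ξ′}_U((ξ∕ξ′)F) = (ξ∕ξ′)²·∇^{ξ}_U F` (the adjoint action is `ℂ`-linear; zero conventions, any `ξ, ξ′`). [cite: Balaban1987RG1, (1.13) p.262] -/
theorem nabla_smul_eq (ξ ξ' : ℝ) (U : PBond P i → 𝔸ˣ) (μ : Fin P.d) (F : Site P i → 𝔸) (x : Site P i) :
    nabla ξ' U μ (fun y => ((ξ / ξ' : ℝ) : ℂ) • F y) x = (((ξ / ξ') ^ 2 : ℝ) : ℂ) • nabla ξ U μ F x := by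
  simp only [nabla, mul_smul_comm, smul_mul_assoc, ← smul_sub, smul_smul]
  congr 1
  push_cast
  field_simp

/-- `(ξ∕ξ′)² ≤ 1`-type bookkeeping: for `0 < ξ ≤ ξ′`, `0 ≤ ξ∕ξ′ ≤ 1` and `0 ≤ (ξ∕ξ′)² ≤ 1`. [folklore] -/
private theorem ratio_bounds {ξ ξ' : ℝ} (hξ : 0 < ξ) (hle : ξ ≤ ξ') :
    0 ≤ ξ / ξ' ∧ ξ / ξ' ≤ 1 ∧ 0 ≤ (ξ / ξ') ^ 2 ∧ (ξ / ξ') ^ 2 ≤ 1 := by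
  have hξ' : 0 < ξ' := hξ.trans_le hle
  have h0 : 0 ≤ ξ / ξ' := div_nonneg hξ.le hξ'.le
  have h1 : ξ / ξ' ≤ 1 := (div_le_one hξ').mpr hle
  exact ⟨h0, h1, sq_nonneg _, pow_le_one₀ h0 h1⟩

/-- **The (1.12) local gauge RESCALES**: a `G`-valued `u` and an `A` with `U^u = exp iξA`, `|A|, |∇^ξA| < B` on a cube-region `C` give, on any sub-region `C′`
(bonds, stencils) and for any `ξ′ ≥ ξ > 0`, the same `u` and `A′ = (ξ∕ξ′)A` with `U^u = exp iξ′A′`, `|A′|, |∇^{ξ′}A′| < B`.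
[cite: Balaban1987RG1, (1.12) p.262] -/
theorem localGauge_of_xi_le {C C' : Region P i} (hbC : C'.bonds ⊆ C.bonds) (hdC : C'.dpairs ⊆ C.dpairs) {ξ ξ' B : ℝ} (hξ : 0 < ξ)
    (hle : ξ ≤ ξ') {U : PBond P i → 𝔸ˣ}
    (h : ∃ u : Site P i → 𝔸ˣ, (∀ x, u x ∈ 𝓜.G) ∧ ∃ A : PBond P i → 𝔸,
      (∀ b ∈ C.bonds, gaugeU u U b = expI ξ (A b)) ∧ (∀ b ∈ C.bonds, ‖A b‖ < B) ∧
        ∀ q ∈ C.dpairs, ‖grad ξ q.2.1 (fun y => A ⟨y, q.2.2⟩) q.1‖ < B) :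
    ∃ u : Site P i → 𝔸ˣ, (∀ x, u x ∈ 𝓜.G) ∧ ∃ A : PBond P i → 𝔸,
      (∀ b ∈ C'.bonds, gaugeU u U b = expI ξ' (A b)) ∧ (∀ b ∈ C'.bonds, ‖A b‖ < B) ∧
        ∀ q ∈ C'.dpairs, ‖grad ξ' q.2.1 (fun y => A ⟨y, q.2.2⟩) q.1‖ < B := by
  obtain ⟨u, hu, A, hgauge, hA, hdA⟩ := h
  have hξ' : 0 < ξ' := hξ.trans_le hle
  obtain ⟨h0, h1, h20, h21⟩ := ratio_bounds hξ hle
  refine ⟨u, hu, fun b => ((ξ / ξ' : ℝ) : ℂ) • A b, fun b hb => ?_, fun b hb => ?_, fun q hq => ?_⟩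
  · rw [hgauge b (hbC hb)]
    exact expI_eq_expI_smul hξ'.ne' (A b)
  · exact (norm_real_smul_le h0 h1 (A b)).trans_lt (hA b (hbC hb))
  · have := hdA q (hdC hq)
    rw [grad_smul_eq, norm_smul, Complex.norm_real, Real.norm_of_nonneg h20]
    exact (mul_le_of_le_one_left (norm_nonneg _) h21).trans_lt this

/-- The plaquette letter `α₀ξ²` is monotone in `ξ` once it is inhabited: `‖·‖ < α₀ξ² ⇒ ‖·‖ < α₀ξ′²` for `0 < ξ ≤ ξ′` (the strict bound forces `0 < α₀`).
[cite: Balaban1987RG1, (1.11) p.262] -/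
theorem lt_mul_sq_of_lt_mul_sq {x α₀ ξ ξ' : ℝ} (hx : 0 ≤ x) (hξ : 0 < ξ) (hle : ξ ≤ ξ') (h : x < α₀ * ξ ^ 2) : x < α₀ * ξ' ^ 2 := by
  have hpos : 0 < α₀ * ξ ^ 2 := hx.trans_lt h
  have hα : 0 ≤ α₀ := by nlinarith [sq_nonneg ξ]
  exact h.trans_le (mul_le_mul_of_nonneg_left (pow_le_pow_left₀ hξ.le hle 2) hα)

/-- ★ **CONDITION (i) passes from `(F, ξ)` to `(F′, ξ′)`** for `0 < ξ ≤ ξ′`, the same `cB`, `F′.X ⊆ F.X` (bonds, plaquettes) and every cube-region of `F′` a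
sub-region of a cube-region of `F`: `G`-valuedness and (1.11) restrict (`α₀ξ² ≤ α₀ξ′²`), (1.12) restricts and rescales (`localGauge_of_xi_le`).
[cite: Balaban1987RG1, (1.11)-(1.12) p.262] -/
theorem condI_of_xi_le {F F' : Frame P i 𝔸} {c c' : StepConsts} {α₀ : ℝ} (hξ : 0 < c.ξ) (hle : c.ξ ≤ c'.ξ) (hcB : c'.cB = c.cB)
    (hXb : F'.X.bonds ⊆ F.X.bonds) (hXp : F'.X.plaqs ⊆ F.X.plaqs)
    (hcubes : ∀ C' ∈ F'.cubes, ∃ C ∈ F.cubes, C'.bonds ⊆ C.bonds ∧ C'.dpairs ⊆ C.dpairs)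
    {U : PBond P i → 𝔸ˣ} (h : CondI 𝓜 F c α₀ U) : CondI 𝓜 F' c' α₀ U := by
  refine ⟨fun b hb => h.gValued b (hXb hb), fun p hp => lt_mul_sq_of_lt_mul_sq (norm_nonneg _) hξ hle (h.plaq_lt p (hXp hp)),
    fun C' hC' => ?_⟩
  obtain ⟨C, hC, hbC, hdC⟩ := hcubes C' hC'
  rw [hcB]
  exact localGauge_of_xi_le hbC hdC hξ hle (h.localGauge C hC)

omit [CompleteSpace 𝔸] in
/-- **CONDITION (ii) passes from `(X, ξ, A′)` to `(X′, ξ′, (ξ∕ξ′)A′)`** (`0 < ξ ≤ ξ′`, `X′ ⊆ X`): `𝔤ᶜ` is a `ℂ`-subspace, `|(ξ∕ξ′)A′| ≤ |A′|`,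
`|∇^{ξ′}_U((ξ∕ξ′)A′)| = (ξ∕ξ′)²|∇^{ξ}_U A′|`. [cite: Balaban1987RG1, (1.13) p.262] -/
theorem condII_of_xi_le {X X' : Region P i} {c c' : StepConsts} {α₁ : ℝ} (hξ : 0 < c.ξ) (hle : c.ξ ≤ c'.ξ)
    (hb : X'.bonds ⊆ X.bonds) (hd : X'.dpairs ⊆ X.dpairs) {U : PBond P i → 𝔸ˣ} {A' : PBond P i → 𝔸}
    (h : CondII 𝓜 X c α₁ U A') : CondII 𝓜 X' c' α₁ U (fun b => ((c.ξ / c'.ξ : ℝ) : ℂ) • A' b) := by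
  have hξ' : 0 < c'.ξ := hξ.trans_le hle
  obtain ⟨h0, h1, h20, h21⟩ := ratio_bounds hξ hle
  refine ⟨fun b hb' => 𝓜.gc.smul_mem _ (h.gcValued b (hb hb')), fun b hb' => (norm_real_smul_le h0 h1 _).trans_lt (h.norm_lt b (hb hb')),
    fun q hq => ?_⟩
  have := h.nabla_lt q (hd hq)
  rw [nabla_smul_eq, norm_smul, Complex.norm_real, Real.norm_of_nonneg h20]
  exact (mul_le_of_le_one_left (norm_nonneg _) h21).trans_lt this

omit [NormedAlgebra ℂ 𝔸] [CompleteSpace 𝔸] in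
/-- **CONDITION (iii) passes from `(X, ξ)` to `(X′, ξ′)`** (`0 < ξ ≤ ξ′`, `X′ ⊆ X`). [cite: Balaban1987RG1, (1.14) p.262] -/
theorem condIII_of_xi_le {X X' : Region P i} {c c' : StepConsts} {α₀ γ₀ : ℝ} (hξ : 0 < c.ξ) (hle : c.ξ ≤ c'.ξ)
    (hp : X'.plaqs ⊆ X.plaqs) (hb : X'.bonds ⊆ X.bonds) {Uc : PBond P i → 𝔸ˣ} {Jc : PBond P i → 𝔸}
    (h : CondIII X c α₀ γ₀ Uc Jc) : CondIII X' c' α₀ γ₀ Uc Jc :=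
  ⟨fun p hp' => lt_mul_sq_of_lt_mul_sq (norm_nonneg _) hξ hle (h.plaq_lt p (hp hp')), fun b hb' => h.J_lt b (hb hb')⟩

/-- **The factorisation `𝐔 = (exp iξA′)·U` rescales**: `exp iξA′ = exp iξ′((ξ∕ξ′)A′)`. [cite: Balaban1987RG1, (1.11) p.262] -/
theorem factors_of_xi_le {c c' : StepConsts} (hξ' : c'.ξ ≠ 0) {Uc U : PBond P i → 𝔸ˣ} {A' : PBond P i → 𝔸} (h : Factors c Uc U A') :
    Factors c' Uc U (fun b => ((c.ξ / c'.ξ : ℝ) : ℂ) • A' b) := fun b => by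
  rw [h b, expI_eq_expI_smul hξ' (A' b)]

/-- ★ **CONDITIONS (i)–(iii) pass from `(F, ξ)` to `(F′, ξ′)`** (`0 < ξ ≤ ξ′`, same `cB`, `F′.X ⊆ F.X` on plaquettes∕bonds∕stencils, cube-regions of `F′` refine
those of `F`): the factorisation and `A′` are rescaled by `ξ∕ξ′`, `U` is kept. [cite: Balaban1987RG1, (1.11)-(1.14) p.262] -/
theorem satisfiesI_III_of_xi_le {F F' : Frame P i 𝔸} {c c' : StepConsts} {α₀ α₁ γ₀ : ℝ} (hξ : 0 < c.ξ) (hle : c.ξ ≤ c'.ξ) (hcB : c'.cB = c.cB)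
    (hXp : F'.X.plaqs ⊆ F.X.plaqs) (hXb : F'.X.bonds ⊆ F.X.bonds) (hXd : F'.X.dpairs ⊆ F.X.dpairs)
    (hcubes : ∀ C' ∈ F'.cubes, ∃ C ∈ F.cubes, C'.bonds ⊆ C.bonds ∧ C'.dpairs ⊆ C.dpairs)
    {Φ : FieldPair P i 𝔸ˣ 𝔸} (h : SatisfiesI_III 𝓜 F c α₀ α₁ γ₀ Φ) : SatisfiesI_III 𝓜 F' c' α₀ α₁ γ₀ Φ := by
  obtain ⟨hG, hg, U, A', hf, h1, h2, h3⟩ := h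
  have hξ' : 0 < c'.ξ := hξ.trans_le hle
  exact ⟨fun b hb => hG b (hXb hb), fun b hb => hg b (hXb hb), U, fun b => ((c.ξ / c'.ξ : ℝ) : ℂ) • A' b, factors_of_xi_le hξ'.ne' hf,
    condI_of_xi_le hξ hle hcB hXb hXp hcubes h1, condII_of_xi_le hξ hle hXb hXd h2, condIII_of_xi_le hξ hle hXp hXb h3⟩

end Rescale

/-! ## §3 AT THE FRAME OF RECORD: conditions (i)–(iii) of level `k` imply those of every level `j ≤ k` at the same table `Y` -/

section Record

variable {P : Params}

-- `0 < ξ_k` is the tree's `BalabanImbrieJaffe1984to88.BIJ85Sigma422Eta.eta_pos` (not restated; used below as the term `pow_pos (inv_pos.mpr P.cast_L_pos) k`).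

/-- `ξ_k ≤ ξ_j` for `j ≤ k` (`L ≥ 1`). [cite: Balaban1987RG1, (1.1) p.260] -/
theorem eta_le_eta_of_le (P : Params) {j k : ℕ} (hjk : j ≤ k) : P.eta k ≤ P.eta j := by
  unfold Params.eta
  have hL1 : (1 : ℝ) ≤ P.L := by exact_mod_cast P.L_pos
  exact pow_le_pow_of_le_one (inv_nonneg.mpr (zero_le_one.trans hL1)) (inv_le_one_of_one_le₀ hL1) hjk

variable {𝔸 : Type*} [NormedRing 𝔸] [NormedAlgebra ℂ 𝔸] [CompleteSpace 𝔸] {𝓜 : Model 𝔸}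

/-- ★ **CONDITION (i) NESTS ACROSS LEVELS AT THE FRAME OF RECORD**: for `j ≤ k`, condition (i) of [I] (1.11)–(1.12) on the frame of record of level `k` at the
table `Y` (cubes `cubesI M k Y`, constants `StepConsts.ofParams P cB k`: `ξ = L^{−k}`) implies condition (i) on the frame of record of level `j` at `Y`
(`ξ = L^{−j}`, same `cB`, `α₀`; the residual recipes `Rz, Rz′` are not read by (i)). [cite: Balaban1987RG1, (1.11)-(1.12) p.262] -/
theorem condI_frameI_of_level_le (Rz Rz' : Residual P 𝔸) (M : ℕ) {j k : ℕ} (hjk : j ≤ k) (Y : Set (Site P 0)) (cB α₀ : ℝ)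
    {U : PBond P 0 → 𝔸ˣ} (h : CondI 𝓜 (frameI Rz M k Y) (StepConsts.ofParams P cB k) α₀ U) :
    CondI 𝓜 (frameI Rz' M j Y) (StepConsts.ofParams P cB j) α₀ U :=
  condI_of_xi_le (F := frameI Rz M k Y) (F' := frameI Rz' M j Y) (c := StepConsts.ofParams P cB k) (c' := StepConsts.ofParams P cB j)
    (pow_pos (inv_pos.mpr P.cast_L_pos) k) (eta_le_eta_of_le P hjk) rfl (fun _ hb => hb) (fun _ hp => hp) (cubesI_nest M hjk Y) h

/-- ★ **CONDITIONS (i)–(iii) NEST ACROSS LEVELS AT THE FRAME OF RECORD**: for `j ≤ k`, `SatisfiesI_III` on the frame of record of level `k` at `Y` implies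
`SatisfiesI_III` on the frame of record of level `j` at `Y` (same `cB, α₀, α₁, γ₀`; the factorisation rescaled by `L^{−(k−j)}`).  Condition (iv) is NOT
covered (its region `X̃⁻²` and functions are level data). [cite: Balaban1987RG1, (1.11)-(1.14) p.262] -/
theorem satisfiesI_III_frameI_of_level_le (Rz Rz' : Residual P 𝔸) (M : ℕ) {j k : ℕ} (hjk : j ≤ k) (Y : Set (Site P 0)) (cB α₀ α₁ γ₀ : ℝ)
    {Φ : FieldPair P 0 𝔸ˣ 𝔸} (h : SatisfiesI_III 𝓜 (frameI Rz M k Y) (StepConsts.ofParams P cB k) α₀ α₁ γ₀ Φ) :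
    SatisfiesI_III 𝓜 (frameI Rz' M j Y) (StepConsts.ofParams P cB j) α₀ α₁ γ₀ Φ :=
  satisfiesI_III_of_xi_le (F := frameI Rz M k Y) (F' := frameI Rz' M j Y) (c := StepConsts.ofParams P cB k) (c' := StepConsts.ofParams P cB j)
    (pow_pos (inv_pos.mpr P.cast_L_pos) k) (eta_le_eta_of_le P hjk) rfl (fun _ hp => hp) (fun _ hb => hb) (fun _ hd => hd) (cubesI_nest M hjk Y) h

end Record

end YMDAG.N18.CondILevelNesting
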